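import Summits.BirchSwinnertonDyer.Rank1Residual.P2.CongruentNumberPairsAtTwoOddPairTable
import Summits.BirchSwinnertonDyer.Rank1Residual.P2.CongruentNumberEvenPairAokiMonsky
import Summits.BirchSwinnertonDyer.Rank1Residual.P2.CongruentNumberEvenFiveSelmerExact
import Literature.NumberTheory.EllipticCurves.CongruentNumberMonskySelmerParityBound
import Literature.NumberTheory.EllipticCurves.CongruentNumberOddMonskySelmerExact
import Literature.NumberTheory.EllipticCurves.CongruentNumberSelmerEightShaTwo
import Literature.NumberTheory.EllipticCurves.Monsky1990.MockHeegnerCongruentNumbers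
import HarnessLib

/-!
# Cell `bsd-monsky`, route A: MONSKY'S REMARK (2) «`S̄ = ℤ/2`» IS A KERNEL THEOREM ON ALL TWELVE Cor. 5.15 FAMILIES —
# `#Sel⁽²⁾(E_N/ℚ) = 8` for every `N` of Monsky 1990 Cor. 5.15, hence `rk E_N(ℚ) ≤ 1`, «`N` congruent ⟺ `Ш(E_N)[2] = 0`
# ⟺ `Ш(E_N)[2^∞] = 0`», and the named fact `h515` REDUCED to Cor. 5.15 AS PRINTED («the following are all congruent numbers»)

HONEST FRAMING (cell `bsd-monsky`, run/shared/lean/pub/bsd-monsky/; README §1): ONE theorem on ONE explicit infinite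
family at the prime `2`; not "BSD for rank ≤ 1", nothing at odd primes; nothing is booked by this file; no mark moved.
Monsky 1990, p. 67 Remark (2), verbatim: «The very patient reader may verify that `S̄ = ℤ/2` and `S̄* = (0)` precisely
when we are in one of the 16 cases listed in Theorems 5.13 and 5.14. In these cases we've shown that the rank of `E^{(N)}_ℚ`
is `≧ 1`; since the rank is bounded by `dim S̄ = 1`, it is exactly one.» Here `S̄ = Sel⁽²⁾(E^{(N)}/ℚ)/E^{(N)}(ℚ)[2]`
(Remark (1): the Selmer group of multiplication by `2`), so «`S̄ = ℤ/2`» is «`#Sel⁽²⁾(E_N/ℚ) = 8`» = Heath-Brown's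
`s(N) = 1`. The tree vendored Cor. 5.15 + Remark (2) as the NAMED FACT
`Monsky1990.cor515_rank_eq_one_and_card_selmerGroup_two` (`h515`: rank `1` and `#Sel⁽²⁾ = 8` on the twelve families
of `IsCor515Family`). THIS FILE makes the «very patient reader» computation a theorem of the kernel for EVERY member of the
twelve families and draws the consequences:

* `card_selmerGroup_two_eq_eight_of_isCor515Family` — **`#Sel⁽²⁾(E_N/ℚ) = 8` for every `N` with `IsCor515Family N`**,
  UNCONDITIONALLY: Monsky's `2`-Selmer formula WITH EQUALITY (prover-B g15, `card_selmerGroup_two_eq_pow`, both parities,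
  `#Sel⁽²⁾(E_D) = 2^{2+s(D)}`) evaluated on the landed `s = 1` tables — `p₅, p₇` (`s(p) = 1`, Heath-Brown's one-prime table),
  `2p₃, 2p₇` (`s(2p) = 1`), `p₃p₅, p₃p₇, p₁p₅ ((p₁/p₅) = −1), p₁p₇ ((p₁/p₇) = −1)` (the odd pair table
  `monskySelmerRankOdd_pair_eq_one_iff`), `2p₃p₅, 2p₅p₇` (`card_selmerGroup_two_eq_eight_two_mul_five_mul`),
  `2p₁p₃, 2p₁p₇` with `(p₁/q) = −1` (`monskySelmerRankEven_one_pair_of_jacobiSym_eq_neg_one`).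
* `mordellWeilRank_le_one_of_isCor515Family` — `rk E_N(ℚ) ≤ 1` on all twelve families (Remark (2)'s «bounded by
  `dim S̄ = 1`»); `mordellWeilRank_eq_one_iff_isCongruentNumber_of_isCor515Family` — `rk = 1 ⟺ N` congruent;
  `isCongruentNumber_iff_primaryComponent_sha_two_eq_bot_of_isCor515Family` — **«`N` congruent ⟺ `Ш(E_N)[2^∞] = 0`»**
  (`SelmerEightShaTwo`).
* `cor515_rank_eq_one_and_card_selmerGroup_two_of_forall_isCongruentNumber` / `…_iff_forall_isCongruentNumber` —
  **the named fact `h515` is EQUIVALENT, in the kernel, to Cor. 5.15 AS PRINTED** («The following are all congruent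
  numbers»): the Selmer clause and the bound `rk ≤ 1` are theorems, «rank `≧ 1`» is «`N` congruent» (Top–Yui).

MEANING: of Monsky's `h515` only the literal corollary «each member is a congruent number» remains a displayed input;
Remark (2)'s computation is discharged. The corner of record of C-P2-1 is untouched (it no longer uses `h515`).
Nothing asserted beyond kernel theorems; no new named fact; no `_holds`.

References: [Monsky1990MockHeegner] Cor. 5.15 (p. 66), Remarks (1)–(2) (pp. 66–67), Thms. 5.13–5.14 (pp. 65–66);
[HeathBrown1994SelmerCongruentII] §1 (typescript p. 1 L14–L20, p. 6 L26–L28), Appendix (Monsky) pp. 38–41;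
[SilvermanAEC2009] Thm. X.4.2; [TopYui2008Congruent] Prop. 3.3 (i) ⟺ (iv).
-/

noncomputable section

open scoped Classical

open WeierstrassCurve Literature.NumberTheory.EllipticCurves
  Literature.NumberTheory.EllipticCurves.HeathBrown1994
  Literature.NumberTheory.EllipticCurves.Monsky1990
  Literature.NumberTheory.EllipticCurves.SelmerEightShaTwo

set_option autoImplicit false

namespace Summit.BirchSwinnertonDyer.Rank1Residual.P2

variable {N : ℕ}

/-! ## §1 The pair cases: `#Sel⁽²⁾ = 8` on the odd and even two-prime families of Cor. 5.15 -/

/-- **Odd two-prime families of Cor. 5.15: `#Sel⁽²⁾(E_{pq}/ℚ) = 8`** for distinct odd primes `p, q` with `pq ≡ 5, 7 (mod 8)`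
and NOT (`(p/q) = +1` with one of them `≡ 1 (mod 8)`) — Monsky's odd formula with equality at `k = 2` on the odd pair
table (`s(pq) = 1`). The tuple is `![q, p]` so that the table's symbol `(t₁/t₀)` is `(p/q)`.
[cite: HeathBrown1994SelmerCongruentII, Appendix (Monsky), typescript p. 39 L10–L33] [cite: Monsky1990MockHeegner, Cor. 5.15 (2)–(3) (p. 66)] -/
theorem card_selmerGroup_two_eq_eight_odd_pair {p q : ℕ} (hp : p.Prime) (hq : q.Prime) (hp2 : p ≠ 2) (hq2 : q ≠ 2)
    (hne : p ≠ q) (h8 : (p * q) % 8 = 5 ∨ (p * q) % 8 = 7)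
    (hsym : ¬ (jacobiSym p q = 1 ∧ (q % 8 = 1 ∨ p % 8 = 1))) :
    Nat.card ((congruentNumberCurve (p * q)).selmerGroup 2) = 8 := by
  have ht : ∀ i, (![q, p] i).Prime := fun i => by fin_cases i <;> assumption
  have ht2 : ∀ i, (![q, p] i) ≠ 2 := fun i => by fin_cases i <;> assumption
  have hinj : Function.Injective ![q, p] := by
    intro i j hij
    fin_cases i <;> fin_cases j
    · rfl
    · exact absurd hij.symm hne
    · exact absurd hij hne
    · rfl
  have h8' : ((![q, p] : Fin 2 → ℕ) 0 * (![q, p] : Fin 2 → ℕ) 1) % 8 = 5 ∨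
      ((![q, p] : Fin 2 → ℕ) 0 * (![q, p] : Fin 2 → ℕ) 1) % 8 = 7 := by
    simpa only [Matrix.cons_val_zero, Matrix.cons_val_one, mul_comm q p] using h8
  have hs : monskySelmerRankOdd ![q, p] = 1 := by
    rw [monskySelmerRankOdd_pair_eq_one_iff _ ht ht2 hinj h8']
    simpa only [Matrix.cons_val_zero, Matrix.cons_val_one] using hsym
  -- the formula at `∏ i, ![q, p] i = p * q` (the product is substituted, not rewritten under the curve)
  have key : ∀ {M : ℕ}, (∏ i, (![q, p] : Fin 2 → ℕ) i) = M →
      Nat.card ((congruentNumberCurve M).selmerGroup 2) = 2 ^ (2 + monskySelmerRankOdd ![q, p]) := by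
    intro M hM
    subst hM
    exact CongruentNumberOddMonskySelmerExact.card_selmerGroup_two_eq_pow ht ht2 hinj
  have hprod : (∏ i, (![q, p] : Fin 2 → ℕ) i) = p * q := by
    rw [Fin.prod_univ_two]
    simp only [Matrix.cons_val_zero, Matrix.cons_val_one]
    exact mul_comm q p
  rw [key hprod, hs]
  norm_num

/-- **Even two-prime families of Cor. 5.15 with a prime `≡ 1 (mod 8)`: `#Sel⁽²⁾(E_{2pq}/ℚ) = 8`** for primes `p ≡ 1 (mod 8)`,
`q ≡ 3 (mod 4)` with `(p/q) = −1` — Monsky's even formula with equality at `k = 2` on the row `s(2pq) = 1`.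
[cite: HeathBrown1994SelmerCongruentII, Appendix (Monsky), typescript p. 41 L20–L36] [cite: Monsky1990MockHeegner, Cor. 5.15 (3) (p. 66)] -/
theorem card_selmerGroup_two_eq_eight_two_mul_one_pair {p q : ℕ} (hp : p.Prime) (hq : q.Prime) (hp1 : p % 8 = 1)
    (hq4 : q % 4 = 3) (hj : jacobiSym p q = -1) :
    Nat.card ((congruentNumberCurve (2 * (p * q))).selmerGroup 2) = 8 := by
  have hne : p ≠ q := fun h => by omega
  have ht : ∀ i, (![p, q] i).Prime := fun i => by fin_cases i <;> assumption
  have ht2 : ∀ i, (![p, q] i) ≠ 2 := by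
    intro i
    fin_cases i
    · show p ≠ 2
      omega
    · show q ≠ 2
      omega
  have hinj : Function.Injective ![p, q] := by
    intro i j hij
    fin_cases i <;> fin_cases j
    · rfl
    · exact absurd hij hne
    · exact absurd hij.symm hne
    · rfl
  have hs : monskySelmerRankEven ![p, q] = 1 :=
    (monskySelmerRankEven_one_pair_of_jacobiSym_eq_neg_one hp hq hp1 hq4 hj).1
  have h := CongruentNumberEvenMonskySelmerExact.card_selmerGroup_two_eq_pow ht ht2 hinj
  rw [Fin.prod_univ_two] at h
  simp only [Matrix.cons_val_zero, Matrix.cons_val_one] at h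
  rw [hs] at h
  exact h

/-! ## §2 Remark (2) on all twelve families: `#Sel⁽²⁾(E_N/ℚ) = 8` -/

/-- **MONSKY'S REMARK (2), THE SELMER CLAUSE, AS A KERNEL THEOREM: `#Sel⁽²⁾(E_N/ℚ) = 8` («`S̄ = ℤ/2`») for EVERY `N` in the
twelve families of Cor. 5.15** (`IsCor515Family N`: `p₅, p₇, 2p₃, 2p₇, p₃p₇, p₃p₅, 2p₃p₅, 2p₅p₇, p₁p₅ ((p₁/p₅) = −1),
p₁p₇ and 2p₁p₇ ((p₁/p₇) = −1), 2p₁p₃ ((p₁/p₃) = −1)`). UNCONDITIONAL: Monsky's `2`-Selmer formula with equality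
(`#Sel⁽²⁾(E_D) = 2^{2+s(D)}`, both parities) on the landed `s = 1` tables. What print leaves «to the very patient reader».
[cite: Monsky1990MockHeegner, Cor. 5.15 (p. 66), Remarks (1)–(2) (pp. 66–67)]
[cite: HeathBrown1994SelmerCongruentII, §1 typescript p. 1 L14–L20 and p. 6 L26–L28; Appendix (Monsky) pp. 39–41] -/
theorem card_selmerGroup_two_eq_eight_of_isCor515Family (hN : IsCor515Family N) :
    Nat.card ((congruentNumberCurve N).selmerGroup 2) = 8 := by
  rcases hN with ⟨hN, h8⟩ | ⟨p, hp, hp8, rfl⟩ | ⟨p, q, hp, hq, hp8, hq8, rfl⟩ | ⟨p, q, hp, hq, hp8, hq8, rfl⟩ |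
      ⟨p, q, hp, hq, hp8, hq8, hj, rfl⟩ | ⟨p, q, hp, hq, hp8, hq8, hj, rfl⟩
  · -- `N = p₅` or `p₇`: the one-prime table `16, 4, 8, 8`
    rw [MonskySelmerParity.card_selmerGroup_two_congruentNumberCurve_prime hN (by omega)]
    rw [if_neg (by omega), if_neg (by omega)]
  · -- `N = 2p₃` or `2p₇`: the table `16, 8, 4, 8`
    rw [MonskySelmerParity.card_selmerGroup_two_congruentNumberCurve_two_mul_prime hp (by omega)]
    rw [if_neg (by omega), if_neg (by omega)]
  · -- `N = p₃p₇` or `p₃p₅`: the odd pair table (no prime `≡ 1 (mod 8)`)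
    refine card_selmerGroup_two_eq_eight_odd_pair hp hq (by omega) (by omega) (by omega) ?_ ?_
    · rw [Nat.mul_mod, hp8]
      rcases hq8 with hq8 | hq8 <;> rw [hq8] <;> decide
    · rintro ⟨-, h1 | h1⟩ <;> omega
  · -- `N = 2p₃p₅` or `2p₅p₇`: the exact count on the even-five family
    exact card_selmerGroup_two_eq_eight_two_mul_five_mul hp hq hp8 (by omega)
  · -- `N = p₁p₅` or `p₁p₇` with `(p₁/q) = −1`: the odd pair table on the symbol `−1`
    refine card_selmerGroup_two_eq_eight_odd_pair hp hq (by omega) (by omega) (by omega) ?_ ?_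
    · rw [Nat.mul_mod, hp8]
      rcases hq8 with hq8 | hq8 <;> rw [hq8] <;> decide
    · rintro ⟨h1, -⟩
      rw [hj] at h1
      norm_num at h1
  · -- `N = 2p₁p₇` or `2p₁p₃` with `(p₁/q) = −1`: the even row `s = 1`
    exact card_selmerGroup_two_eq_eight_two_mul_one_pair hp hq hp8 (by omega) hj

/-! ## §3 Consequences on all twelve families: `rk ≤ 1`, «congruent ⟺ `Ш[2] = 0` ⟺ `Ш[2^∞] = 0`» -/

/-- **`rk E_N(ℚ) ≤ 1` on all twelve Cor. 5.15 families** (Remark (2): «the rank is bounded by `dim S̄ = 1`»), unconditionally.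
[cite: Monsky1990MockHeegner, Remark (2) (p. 67)] [cite: SilvermanAEC2009, Thm. X.4.2] -/
theorem mordellWeilRank_le_one_of_isCor515Family (hN : IsCor515Family N) :
    haveI := isElliptic_congruentNumberCurve hN.ne_zero
    (congruentNumberCurve N).mordellWeilRank ≤ 1 := by
  haveI := isElliptic_congruentNumberCurve hN.ne_zero
  exact (natCard_sha_two_eq_pow_sub hN.ne_zero (s := 1)
    (by rw [card_selmerGroup_two_eq_eight_of_isCor515Family hN]; norm_num)).1

/-- **On all twelve Cor. 5.15 families: `rk E_N(ℚ) = 1 ⟺ N` is a congruent number** (`rk ≤ 1` and Top–Yui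
`rk ≠ 0 ⟺` congruent), unconditionally. [cite: Monsky1990MockHeegner, Remark (2) (p. 67); Lemma 3.3 (3) (p. 53)]
[cite: TopYui2008Congruent, Prop. 3.3 (i) ⟺ (iv)] -/
theorem mordellWeilRank_eq_one_iff_isCongruentNumber_of_isCor515Family (hN : IsCor515Family N) :
    haveI := isElliptic_congruentNumberCurve hN.ne_zero
    (congruentNumberCurve N).mordellWeilRank = 1 ↔ IsCongruentNumber N := by
  haveI := isElliptic_congruentNumberCurve hN.ne_zero
  rw [← Wiles2000.mordellWeilRank_ne_zero_iff_isCongruentNumber (Nat.pos_of_ne_zero hN.ne_zero)]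
  have hle := mordellWeilRank_le_one_of_isCor515Family hN
  omega

/-- **On all twelve Cor. 5.15 families: `N` congruent ⟺ `Ш(E_N)[2] = 0`**, unconditionally.
[cite: Monsky1990MockHeegner, Remark (2) (p. 67)] [cite: TopYui2008Congruent, Prop. 3.3 (i) ⟺ (iv)] [cite: SilvermanAEC2009, Thm. X.4.2] -/
theorem isCongruentNumber_iff_sha_two_eq_bot_of_isCor515Family (hN : IsCor515Family N) :
    haveI := isElliptic_congruentNumberCurve hN.ne_zero
    IsCongruentNumber N ↔
      ((congruentNumberCurve N).sha ⊓ AddSubgroup.torsionBy (congruentNumberCurve N).galH1 2 :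
        AddSubgroup (congruentNumberCurve N).galH1) = ⊥ :=
  isCongruentNumber_iff_sha_two_eq_bot_of_card_selmerGroup_two_eq_eight hN.ne_zero
    (card_selmerGroup_two_eq_eight_of_isCor515Family hN)

/-- **On all twelve Cor. 5.15 families: `N` congruent ⟺ `Ш(E_N)[2^∞] = 0`**, unconditionally — Remark (2)'s
«rank exactly one» and `Ш[2^∞] = 0` are the SAME statement as Cor. 5.15's «`N` is a congruent number».
[cite: Monsky1990MockHeegner, Cor. 5.15 (p. 66), Remark (2) (p. 67)] [cite: TopYui2008Congruent, Prop. 3.3 (i) ⟺ (iv)]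
[cite: SilvermanAEC2009, Thm. X.4.2] -/
theorem isCongruentNumber_iff_primaryComponent_sha_two_eq_bot_of_isCor515Family (hN : IsCor515Family N) :
    haveI := isElliptic_congruentNumberCurve hN.ne_zero
    IsCongruentNumber N ↔ AddCommGroup.primaryComponent (congruentNumberCurve N).sha 2 = ⊥ :=
  isCongruentNumber_iff_primaryComponent_sha_two_eq_bot_of_card_selmerGroup_two_eq_eight hN.ne_zero
    (card_selmerGroup_two_eq_eight_of_isCor515Family hN)

/-- **A non-congruent member of a Cor. 5.15 family would have `rk = 0` and `#Ш(E_N)[2] = 2`** (the other branch of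
`#Sel⁽²⁾ = 8`), unconditionally. [cite: SilvermanAEC2009, Thm. X.4.2] [cite: TopYui2008Congruent, Prop. 3.3 (i) ⟺ (iv)] -/
theorem mordellWeilRank_eq_zero_and_card_sha_two_eq_two_of_isCor515Family_of_not_isCongruentNumber
    (hN : IsCor515Family N) (h : ¬ IsCongruentNumber N) :
    haveI := isElliptic_congruentNumberCurve hN.ne_zero
    (congruentNumberCurve N).mordellWeilRank = 0 ∧
      Nat.card ((congruentNumberCurve N).sha ⊓ AddSubgroup.torsionBy (congruentNumberCurve N).galH1 2 :
        AddSubgroup (congruentNumberCurve N).galH1) = 2 :=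
  mordellWeilRank_eq_zero_and_card_sha_two_eq_two_of_not_isCongruentNumber hN.ne_zero
    (card_selmerGroup_two_eq_eight_of_isCor515Family hN) h

/-! ## §4 The named fact `h515` reduced to Cor. 5.15 as printed -/

/-- **`h515` FROM COR. 5.15 AS PRINTED.** Granted only the literal corollary «The following are all congruent numbers»
(`∀ N, IsCor515Family N → IsCongruentNumber N`), the tree's named fact `cor515_rank_eq_one_and_card_selmerGroup_two`
(rank exactly `1` and `#Sel⁽²⁾ = 8` on the twelve families) is a THEOREM: the Selmer clause is §2, the rank clause is
`rk ≤ 1` (§3) with Top–Yui's «congruent ⟹ rank `≠ 0`». Remark (2)'s computation is thereby discharged in the kernel;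
the only remaining content of `h515` is Monsky's printed corollary itself. Conditional on that corollary; nothing asserted.
[cite: Monsky1990MockHeegner, Cor. 5.15 (p. 66), Remark (2) (p. 67)] [cite: TopYui2008Congruent, Prop. 3.3 (i) ⟺ (iv)] -/
theorem cor515_rank_eq_one_and_card_selmerGroup_two_of_forall_isCongruentNumber
    (hC : ∀ N : ℕ, IsCor515Family N → IsCongruentNumber N) :
    cor515_rank_eq_one_and_card_selmerGroup_two := by
  intro N _ hN
  have h8 := card_selmerGroup_two_eq_eight_of_isCor515Family hN
  have hr := (mordellWeilRank_eq_one_iff_isCongruentNumber_of_isCor515Family hN).mpr (hC N hN)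
  exact ⟨hr, h8⟩

/-- **`h515` ⟺ Cor. 5.15 AS PRINTED**: the named fact `cor515_rank_eq_one_and_card_selmerGroup_two` is EQUIVALENT in the
kernel to «every member of the twelve families is a congruent number». (The forward direction is the tree's
`isCongruentNumber_of_cor515`.) Neither side asserted.
[cite: Monsky1990MockHeegner, Cor. 5.15 (p. 66), Remark (2) (p. 67)] [cite: TopYui2008Congruent, Prop. 3.3 (i) ⟺ (iv)] -/
theorem cor515_rank_eq_one_and_card_selmerGroup_two_iff_forall_isCongruentNumber :
    cor515_rank_eq_one_and_card_selmerGroup_two ↔ ∀ N : ℕ, IsCor515Family N → IsCongruentNumber N :=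
  ⟨fun h _ hN => isCongruentNumber_of_cor515 h hN,
    cor515_rank_eq_one_and_card_selmerGroup_two_of_forall_isCongruentNumber⟩

end Summit.BirchSwinnertonDyer.Rank1Residual.P2

end
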